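import Literature.Analysis.Complex.LengthArea
import Mathlib.MeasureTheory.Measure.Lebesgue.VolumeOfBalls
import HarnessLib

/-!
# The length–area argument with a uniform lower bound on the crosscut radius

Support for the *equicontinuity* form of Carathéodory's theorem (Pommerenke, *Boundary Behaviour
of Conformal Maps* (1992), Prop. 2.3 and Cor. 2.4): Wolff's lemma
`Literature.Analysis.Complex.LengthArea.exists_short_crosscut` (op. cit. Prop. 2.2) produces, for a
univalent `f` on the unit disc with image of finite area and `ε > 0`, a radius `r ≤ ε` such that
the crosscut `f (𝔻 ∩ {|w - ζ| = r})` has length `≤ ε`. Its proof (pigeonhole on `(δ, √δ)` with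
`δ = min (ε², 1/2) · exp (-2K/ε²)`, `K = ∫ r Λ(r)² dr ≤ 2π · area`) in fact gives `r > δ`, a lower
bound depending only on `ε` and an upper bound for the area. This file records that quantitative
form, which is what makes the modulus of continuity at the boundary UNIFORM over a family of
conformal maps with uniformly bounded images:

* `exists_forall_mul_le_of_lintegral_le`: for `K₀ ≥ 0`, `ε > 0` there is `δ ∈ (0, 1)` such that
  every `Λ` with `∫_{r>0} r Λ(r)² dr ≤ K₀` has some `r ∈ (δ, ε] ∩ (0, 1)` with `r Λ(r) ≤ ε`;
* `exists_radius_forall_short_crosscut`: Wolff's lemma with `r ∈ (r₀, ε]`, `r₀ = r₀(ε, A₀)`, for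
  every univalent `f` on `𝔻` whose image has area `≤ A₀`;
* `exists_radius_forall_short_crosscut_of_subset_ball`: the same over all univalent `f` with
  `f (𝔻) ⊆ B(c, M)` (area `M² π`, Mathlib `Complex.volume_ball`).

Theorems only (no definitions, no named facts); nothing is restated from `LengthArea.lean` (whose
lemmas are used); the radius is produced existentially, BEFORE the function is chosen.

## References

* Ch. Pommerenke, *Boundary Behaviour of Conformal Maps*, Springer (1992), Prop. 2.2, Prop. 2.3.
* J. B. Garnett, D. E. Marshall, *Harmonic Measure*, CUP (2005), Lemma I.3.2.
-/

noncomputable section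

open Set Filter Metric MeasureTheory Real
open _root_.Complex
open scoped ENNReal NNReal Topology

namespace Literature.Analysis.Complex

namespace LengthArea

/-! ### Pigeonhole with a radius chosen before the function -/

/-- **Pigeonhole for the length–area inequality, uniform form.** For `K₀ ≥ 0` and `ε > 0` there
is `δ ∈ (0, 1)` (namely `δ = min (ε², 1/2) · exp (-(2K₀/ε²))`) such that EVERY `Λ` with
`∫_{r>0} r Λ(r)² dr ≤ K₀` admits `r ∈ (δ, ε] ∩ (0, 1)` with `r Λ(r) ≤ ε`: otherwise
`ε²/r ≤ r Λ(r)²` on `(δ, √δ)` and integrating gives `ε² · ½ log (1/δ) ≤ K₀`, while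
`log (1/δ) > 2K₀/ε²`. Pommerenke (1992), proof of Prop. 2.2. [cite: PommerenkeBBCM1992, Prop. 2.2] -/
theorem exists_forall_mul_le_of_lintegral_le {K₀ : ℝ} (hK₀ : 0 ≤ K₀) {ε : ℝ} (hε : 0 < ε) :
    ∃ δ ∈ Ioo (0 : ℝ) 1, ∀ Λ : ℝ → ℝ≥0∞,
      ∫⁻ r in Ioi (0 : ℝ), ENNReal.ofReal r * Λ r ^ 2 ≤ ENNReal.ofReal K₀ →
      ∃ r ∈ Ioo (0 : ℝ) 1, δ < r ∧ r ≤ ε ∧ ENNReal.ofReal r * Λ r ≤ ENNReal.ofReal ε := by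
  set δ : ℝ := min (ε ^ 2) (1 / 2) * Real.exp (-(2 * K₀ / ε ^ 2)) with hδdef
  have hε2 : 0 < ε ^ 2 := by positivity
  have hmin : 0 < min (ε ^ 2) (1 / 2) := lt_min hε2 (by norm_num)
  have hδ : 0 < δ := mul_pos hmin (Real.exp_pos _)
  have hexp_le : Real.exp (-(2 * K₀ / ε ^ 2)) ≤ 1 := by
    rw [Real.exp_le_one_iff, neg_nonpos]; positivity
  have hδε : δ ≤ ε ^ 2 :=
    (mul_le_of_le_one_right hmin.le hexp_le).trans (min_le_left _ _)
  have hδ1 : δ < 1 :=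
    (mul_le_of_le_one_right hmin.le hexp_le).trans_lt ((min_le_right _ _).trans_lt (by norm_num))
  refine ⟨δ, ⟨hδ, hδ1⟩, fun Λ hK ↦ ?_⟩
  by_contra hcon
  push Not at hcon
  have hlog : 2 * K₀ / ε ^ 2 < Real.log (1 / δ) := by
    rw [one_div, Real.log_inv, hδdef, Real.log_mul hmin.ne' (Real.exp_pos _).ne', Real.log_exp]
    have : Real.log (min (ε ^ 2) (1 / 2)) < 0 :=
      Real.log_neg hmin ((min_le_right _ _).trans_lt (by norm_num))
    linarith
  have hsqrt : √δ ≤ ε := by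
    calc √δ ≤ √(ε ^ 2) := Real.sqrt_le_sqrt hδε
      _ = ε := Real.sqrt_sq hε.le
  have hs1 : √δ < 1 := by rw [Real.sqrt_lt' one_pos]; simpa using hδ1
  -- pointwise lower bound on `(δ, √δ)`
  have hpt : ∀ r ∈ Ioo δ (√δ), ENNReal.ofReal (ε ^ 2 / r) ≤ ENNReal.ofReal r * Λ r ^ 2 := by
    intro r hr
    have hr0 : 0 < r := hδ.trans hr.1
    exact ofReal_sq_div_le hr0 hε.le (hcon r ⟨hr0, hr.2.trans hs1⟩ hr.1 (hr.2.le.trans hsqrt)).le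
  have hI := lintegral_sq_div ε hδ hδ1
  have h1 : ENNReal.ofReal (ε ^ 2 * (Real.log (1 / δ) / 2)) ≤ ENNReal.ofReal K₀ := by
    rw [← hI]
    calc ∫⁻ r in Ioo δ (√δ), ENNReal.ofReal (ε ^ 2 / r)
        ≤ ∫⁻ r in Ioo δ (√δ), ENNReal.ofReal r * Λ r ^ 2 := setLIntegral_mono' measurableSet_Ioo hpt
      _ ≤ ∫⁻ r in Ioi (0 : ℝ), ENNReal.ofReal r * Λ r ^ 2 :=
          lintegral_mono_set fun r hr ↦ (hδ.trans hr.1 : 0 < r)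
      _ ≤ ENNReal.ofReal K₀ := hK
  have h2 : ε ^ 2 * (Real.log (1 / δ) / 2) ≤ K₀ := (ENNReal.ofReal_le_ofReal_iff hK₀).1 h1
  have h3 : K₀ < ε ^ 2 * (Real.log (1 / δ) / 2) := by
    rw [div_lt_iff₀ hε2] at hlog
    linarith
  linarith

/-! ### Wolff's lemma with a uniform lower bound on the radius -/

/-- **Wolff's lemma with a radius bounded below, uniformly over a family** (Pommerenke (1992),
Prop. 2.2 in the quantitative form used for Prop. 2.3): for `A₀ ≥ 0` and `ε > 0` there is
`r₀ ∈ (0, 1)` such that for EVERY `f` holomorphic and injective on the unit disc with image of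
area `≤ A₀` and every `‖ζ‖ = 1` there is a radius `r ∈ (r₀, ε] ∩ (0, 1)` whose crosscut
`t ↦ f (ζ - ζ r e^{it})`, `|t| < arccos (r/2)`, has endpoints `a`, `b`, stays within `ε` of `a`,
and has `dist a b ≤ ε`. [cite: PommerenkeBBCM1992, Prop. 2.2] -/
theorem exists_radius_forall_short_crosscut {A₀ : ℝ} (hA₀ : 0 ≤ A₀) {ε : ℝ} (hε : 0 < ε) :
    ∃ r₀ ∈ Ioo (0 : ℝ) 1, ∀ (f : ℂ → ℂ) (ζ : ℂ), DifferentiableOn ℂ f (ball 0 1) →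
      InjOn f (ball 0 1) → volume (f '' ball 0 1) ≤ ENNReal.ofReal A₀ → ‖ζ‖ = 1 →
      ∃ r ∈ Ioo (0 : ℝ) 1, r₀ < r ∧ r ≤ ε ∧ ∃ a b : ℂ,
        Tendsto (fun t ↦ f (cpt ζ r t)) (𝓝[>] (-arccos (r / 2))) (𝓝 a) ∧
        Tendsto (fun t ↦ f (cpt ζ r t)) (𝓝[<] (arccos (r / 2))) (𝓝 b) ∧
        (∀ t ∈ Ioo (-arccos (r / 2)) (arccos (r / 2)), dist (f (cpt ζ r t)) a ≤ ε) ∧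
        dist a b ≤ ε := by
  have hK₀ : 0 ≤ 2 * π * A₀ := by positivity
  obtain ⟨r₀, hr₀, H⟩ := exists_forall_mul_le_of_lintegral_le hK₀ hε
  refine ⟨r₀, hr₀, fun f ζ hf hinj hA hζ ↦ ?_⟩
  -- the bound `∫ r ℓ(r)² dr ≤ 2π A₀` and the uniform pigeonhole
  have hK : ∫⁻ r in Ioi (0 : ℝ), ENNReal.ofReal r * angLen f ζ r ^ 2 ≤ ENNReal.ofReal (2 * π * A₀) := by
    calc ∫⁻ r in Ioi (0 : ℝ), ENNReal.ofReal r * angLen f ζ r ^ 2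
        ≤ ENNReal.ofReal (2 * π) * volume (f '' ball 0 1) := lintegral_angLen_sq_le hf hinj hζ
      _ ≤ ENNReal.ofReal (2 * π) * ENNReal.ofReal A₀ := by gcongr
      _ = ENNReal.ofReal (2 * π * A₀) := by rw [← ENNReal.ofReal_mul (by positivity)]
  obtain ⟨r, ⟨hr0, hr1⟩, hrδ, hrε, hlen⟩ := H (angLen f ζ) hK
  set α : ℝ := arccos (r / 2) with hα
  have hαpos : 0 < α := arccos_pos.2 (by linarith)
  have hαpi : α ≤ π := arccos_le_pi _
  have hmem : ∀ s ∈ Ioo (-α) α, cpt ζ r s ∈ ball (0 : ℂ) 1 := fun s hs ↦ by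
    have habs : |s| < α := abs_lt.2 hs
    exact (mem_ball_cpt_iff_abs_lt hζ hr0 (by linarith) (habs.le.trans hαpi)).2 habs
  -- the crosscut as a `C¹` curve of length `≤ ε`
  set c : ℝ → ℂ := fun t ↦ f (cpt ζ r t) with hc
  set c' : ℝ → ℂ := fun t ↦ deriv f (cpt ζ r t) * -(ζ * (circleMap 0 r t * I)) with hc'
  have hderiv : ∀ s ∈ Ioo (-α) α, HasDerivAt c (c' s) s := fun s hs ↦
    ((hf.differentiableAt (isOpen_ball.mem_nhds (hmem s hs))).hasDerivAt.comp s
      (hasDerivAt_cpt ζ r s))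
  have hcont : ContinuousOn c' (Ioo (-α) α) := by
    have hd : ContinuousOn (deriv f) (ball (0 : ℂ) 1) :=
      ((hf.analyticOnNhd isOpen_ball).deriv).continuousOn
    refine (hd.comp (continuous_cpt ζ r).continuousOn hmem).mul ?_
    fun_prop
  have hL : ∫⁻ s in Ioo (-α) α, ‖c' s‖ₑ ≤ ENNReal.ofReal ε := by
    calc ∫⁻ s in Ioo (-α) α, ‖c' s‖ₑ = ∫⁻ s in Ioo (-α) α, der f (cpt ζ r s) * ENNReal.ofReal r := by
          refine setLIntegral_congr_fun measurableSet_Ioo fun s hs ↦ ?_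
          rw [hc', enorm_mul, der, indicator_of_mem (hmem s hs), ofReal_norm,
            ← ofReal_norm (-(ζ * (circleMap 0 r s * I))), norm_deriv_cpt hζ hr0.le]
      _ = (∫⁻ s in Ioo (-α) α, der f (cpt ζ r s)) * ENNReal.ofReal r :=
          lintegral_mul_const' _ _ ENNReal.ofReal_ne_top
      _ ≤ angLen f ζ r * ENNReal.ofReal r := by
          gcongr
          exact lintegral_mono_set (Ioo_subset_Ioo (neg_le_neg hαpi) hαpi)
      _ ≤ ENNReal.ofReal ε := by rwa [mul_comm]
  have hLtop : ∫⁻ s in Ioo (-α) α, ‖c' s‖ₑ ≠ ⊤ := ne_top_of_le_ne_top ENNReal.ofReal_ne_top hL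
  have hLε : (∫⁻ s in Ioo (-α) α, ‖c' s‖ₑ).toReal ≤ ε :=
    ENNReal.toReal_le_of_le_ofReal hε.le hL
  have hab : -α < α := by linarith
  obtain ⟨a, ha⟩ := exists_tendsto_nhdsGT hab hderiv hcont hLtop
  obtain ⟨b, hb⟩ := exists_tendsto_nhdsLT hab hderiv hcont hLtop
  refine ⟨r, ⟨hr0, hr1⟩, hrδ, hrε, a, b, ha, hb, fun t ht ↦ ?_, ?_⟩
  · exact (dist_le_of_tendsto hderiv hcont hLtop ha hab ht).trans hLε
  · exact (dist_le_of_tendsto_of_tendsto hderiv hcont hLtop ha hb hab).trans hLε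

/-- **Wolff's lemma, uniformly over univalent maps into a fixed disc**: for `M ≥ 0` and `ε > 0`
there is `r₀ ∈ (0, 1)` such that every `f` univalent on `𝔻` with `f (𝔻) ⊆ B(c, M)` has, near
every `‖ζ‖ = 1`, a crosscut at some distance `r ∈ (r₀, ε]` of length `≤ ε` (area of
`B(c, M)` is `M² π`, Mathlib `Complex.volume_ball`). This is the length–area input of the
equicontinuity statement Pommerenke (1992), Prop. 2.3. [cite: PommerenkeBBCM1992, Prop. 2.3] -/
theorem exists_radius_forall_short_crosscut_of_subset_ball {M : ℝ} (hM : 0 ≤ M) {ε : ℝ}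
    (hε : 0 < ε) :
    ∃ r₀ ∈ Ioo (0 : ℝ) 1, ∀ (f : ℂ → ℂ) (c ζ : ℂ), DifferentiableOn ℂ f (ball 0 1) →
      InjOn f (ball 0 1) → f '' ball 0 1 ⊆ ball c M → ‖ζ‖ = 1 →
      ∃ r ∈ Ioo (0 : ℝ) 1, r₀ < r ∧ r ≤ ε ∧ ∃ a b : ℂ,
        Tendsto (fun t ↦ f (cpt ζ r t)) (𝓝[>] (-arccos (r / 2))) (𝓝 a) ∧
        Tendsto (fun t ↦ f (cpt ζ r t)) (𝓝[<] (arccos (r / 2))) (𝓝 b) ∧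
        (∀ t ∈ Ioo (-arccos (r / 2)) (arccos (r / 2)), dist (f (cpt ζ r t)) a ≤ ε) ∧
        dist a b ≤ ε := by
  obtain ⟨r₀, hr₀, H⟩ := exists_radius_forall_short_crosscut (A₀ := M ^ 2 * π) (by positivity) hε
  refine ⟨r₀, hr₀, fun f c ζ hf hinj hsub hζ ↦ H f ζ hf hinj ?_ hζ⟩
  calc volume (f '' ball 0 1) ≤ volume (ball c M) := measure_mono hsub
    _ = ENNReal.ofReal (M ^ 2 * π) := by
        rw [Complex.volume_ball, ENNReal.ofReal_mul (by positivity), ← ENNReal.ofReal_pow hM,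
          ← NNReal.coe_real_pi, ENNReal.ofReal_coe_nnreal]

end LengthArea

end Literature.Analysis.Complex
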